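import Mathlib
import Summits.PneNP.PneNP.Theorems.ConvexRankGatesConvexGateBlindCatchTwo

/-!
# PneNP / ConvexRankGates — `ConvexGateBlind`: the ℓ₁-constant of clique-non-negative weightings is at least `k − 1`

Helpers (`--supports stmt-PneNP-10680`), COLUMN-SPACE line (prover seat 2, session 16).

The ℓ₁-DOMINATION CONSTANT `L*(m,k) = sup ‖w‖₁ / w(E)` over non-zero `k`-clique-non-negative edge weightings `w` of `K_m`
governs the variance term of both catch bounds (`…NegCoverCatch`, `…CatchTwo`): the tree has `L* ≤ 2k² − 4k + 1`
(`…CliqueNonnegL1.abs_sum_le_of_cliqueNonneg`, least-squares certificate). Here the matching-order LOWER bound: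

THEOREM (`l1_constant_ge`, stub). For `4 ≤ k`, `k + 2 ≤ m` there is a `k`-clique-non-negative `w` with `w(E) > 0` and
`‖w‖₁ > (k − 1)·w(E)`. The witness is the CUT WEIGHTING of a balanced bipartition `(S, Sᶜ)`: `+1` inside `S` and inside `Sᶜ`,
`−(1 − 2/k)` across. On a `k`-set meeting `S` in `a` vertices its double sum is EXACTLY `(4(k−1)/k)·(a − k/2)² ≥ 0`
(`block_sum_sum`), and `‖w‖₁/w(E) = (k−1) + k(k−2)/(m−k)`-ish for the balanced cut. So `k − 1 < L* ≤ 2k² − 4k + 1`; the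
companion file `…L1Montgomery` shows `L* = O(k)` conditionally on Montgomery's fractional clique-decomposition theorem, so that
`L* = Θ(k)`: the ℓ₁-constant is the inverse of the fractional `K_k`-decomposition threshold. [new]
-/

set_option linter.dupNamespace false

namespace Summit.PneNP.PneNP.Theorems

open Finset Real Literature.Computability.Complexity
open Summit.PneNP.PneNP.Cruxes.ConvexGateBlind.StrictRankConicCover (Edge)

noncomputable section

variable {m : ℕ}

/-! ## Block weightings of a bipartition -/

/-- **Row sums of a block weighting.** If `V x y = 0` on the diagonal and otherwise `α` (both in `S`), `β` (both outside `S`),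
`γ` (across), then for `x ∈ Q`: `∑_{y∈Q} V x y = (a−1)α + bγ` (`x ∈ S`) resp. `aγ + (b−1)β` (`x ∉ S`), `a = #(Q∩S)`,
`b = #(Q∖S)`. [folklore] -/
theorem block_row_sum {S : Finset (Fin m)} {α β γ : ℝ} {V : Fin m → Fin m → ℝ}
    (hVdef : ∀ x y, V x y = if x = y then 0 else
      if x ∈ S then (if y ∈ S then α else γ) else (if y ∈ S then γ else β))
    (Q : Finset (Fin m)) {x : Fin m} (hx : x ∈ Q) :
    ∑ y ∈ Q, V x y =
      if x ∈ S then (((Q.filter (· ∈ S)).card : ℝ) - 1) * α + ((Q.filter (· ∉ S)).card : ℝ) * γ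
      else ((Q.filter (· ∈ S)).card : ℝ) * γ + (((Q.filter (· ∉ S)).card : ℝ) - 1) * β := by
  classical
  rw [← Finset.sum_filter_add_sum_filter_not Q (· ∈ S)]
  by_cases hxS : x ∈ S
  · rw [if_pos hxS]
    have h1 : ∑ y ∈ Q.filter (· ∈ S), V x y = (((Q.filter (· ∈ S)).card : ℝ) - 1) * α := by
      have hxin : x ∈ Q.filter (· ∈ S) := Finset.mem_filter.2 ⟨hx, hxS⟩
      rw [← Finset.add_sum_erase _ _ hxin, show V x x = 0 by rw [hVdef, if_pos rfl], zero_add]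
      have : ∀ y ∈ (Q.filter (· ∈ S)).erase x, V x y = α := by
        intro y hy
        have hyx : y ≠ x := Finset.ne_of_mem_erase hy
        have hyS : y ∈ S := (Finset.mem_filter.1 (Finset.mem_of_mem_erase hy)).2
        rw [hVdef, if_neg (Ne.symm hyx), if_pos hxS, if_pos hyS]
      rw [Finset.sum_congr rfl this, Finset.sum_const, nsmul_eq_mul, Finset.card_erase_of_mem hxin,
        Nat.cast_sub (Finset.card_pos.2 ⟨x, hxin⟩), Nat.cast_one]
    have h2 : ∑ y ∈ Q.filter (· ∉ S), V x y = ((Q.filter (· ∉ S)).card : ℝ) * γ := by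
      have : ∀ y ∈ Q.filter (· ∉ S), V x y = γ := by
        intro y hy
        have hyS : y ∉ S := (Finset.mem_filter.1 hy).2
        have hyx : x ≠ y := fun h => hyS (h ▸ hxS)
        rw [hVdef, if_neg hyx, if_pos hxS, if_neg hyS]
      rw [Finset.sum_congr rfl this, Finset.sum_const, nsmul_eq_mul]
    rw [h1, h2]
  · rw [if_neg hxS]
    have h1 : ∑ y ∈ Q.filter (· ∈ S), V x y = ((Q.filter (· ∈ S)).card : ℝ) * γ := by
      have : ∀ y ∈ Q.filter (· ∈ S), V x y = γ := by
        intro y hy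
        have hyS : y ∈ S := (Finset.mem_filter.1 hy).2
        have hyx : x ≠ y := fun h => hxS (h ▸ hyS)
        rw [hVdef, if_neg hyx, if_neg hxS, if_pos hyS]
      rw [Finset.sum_congr rfl this, Finset.sum_const, nsmul_eq_mul]
    have h2 : ∑ y ∈ Q.filter (· ∉ S), V x y = (((Q.filter (· ∉ S)).card : ℝ) - 1) * β := by
      have hxin : x ∈ Q.filter (· ∉ S) := Finset.mem_filter.2 ⟨hx, hxS⟩
      rw [← Finset.add_sum_erase _ _ hxin, show V x x = 0 by rw [hVdef, if_pos rfl], zero_add]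
      have : ∀ y ∈ (Q.filter (· ∉ S)).erase x, V x y = β := by
        intro y hy
        have hyx : y ≠ x := Finset.ne_of_mem_erase hy
        have hyS : y ∉ S := (Finset.mem_filter.1 (Finset.mem_of_mem_erase hy)).2
        rw [hVdef, if_neg (Ne.symm hyx), if_neg hxS, if_neg hyS]
      rw [Finset.sum_congr rfl this, Finset.sum_const, nsmul_eq_mul, Finset.card_erase_of_mem hxin,
        Nat.cast_sub (Finset.card_pos.2 ⟨x, hxin⟩), Nat.cast_one]
    rw [h1, h2]

/-- **Double sums of a block weighting:** `∑_{x,y ∈ Q} V x y = a(a−1)α + b(b−1)β + 2abγ`. [folklore] -/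
theorem block_sum_sum {S : Finset (Fin m)} {α β γ : ℝ} {V : Fin m → Fin m → ℝ}
    (hVdef : ∀ x y, V x y = if x = y then 0 else
      if x ∈ S then (if y ∈ S then α else γ) else (if y ∈ S then γ else β))
    (Q : Finset (Fin m)) :
    ∑ x ∈ Q, ∑ y ∈ Q, V x y =
      ((Q.filter (· ∈ S)).card : ℝ) * ((((Q.filter (· ∈ S)).card : ℝ) - 1) * α) +
      ((Q.filter (· ∉ S)).card : ℝ) * ((((Q.filter (· ∉ S)).card : ℝ) - 1) * β) +
      2 * ((Q.filter (· ∈ S)).card : ℝ) * ((Q.filter (· ∉ S)).card : ℝ) * γ := by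
  classical
  rw [Finset.sum_congr rfl (fun x hx => block_row_sum hVdef Q hx), ← Finset.sum_filter_add_sum_filter_not Q (· ∈ S)]
  have h1 : ∀ x ∈ Q.filter (· ∈ S),
      (if x ∈ S then (((Q.filter (· ∈ S)).card : ℝ) - 1) * α + ((Q.filter (· ∉ S)).card : ℝ) * γ
        else ((Q.filter (· ∈ S)).card : ℝ) * γ + (((Q.filter (· ∉ S)).card : ℝ) - 1) * β) =
      (((Q.filter (· ∈ S)).card : ℝ) - 1) * α + ((Q.filter (· ∉ S)).card : ℝ) * γ :=
    fun x hx => if_pos (Finset.mem_filter.1 hx).2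
  have h2 : ∀ x ∈ Q.filter (· ∉ S),
      (if x ∈ S then (((Q.filter (· ∈ S)).card : ℝ) - 1) * α + ((Q.filter (· ∉ S)).card : ℝ) * γ
        else ((Q.filter (· ∈ S)).card : ℝ) * γ + (((Q.filter (· ∉ S)).card : ℝ) - 1) * β) =
      ((Q.filter (· ∈ S)).card : ℝ) * γ + (((Q.filter (· ∉ S)).card : ℝ) - 1) * β :=
    fun x hx => if_neg (Finset.mem_filter.1 hx).2
  rw [Finset.sum_congr rfl h1, Finset.sum_congr rfl h2, Finset.sum_const, Finset.sum_const, nsmul_eq_mul, nsmul_eq_mul]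
  ring

/-! ## The cut weighting -/

/-- **The cut weighting is clique-non-negative, exactly.** With `α = β = 1`, `γ = −(1 − 2/k)` (`0 < k`), on any set `Q`:
`∑_{x,y ∈ Q} V x y = (4(k−1)/k)·(a − #Q/2)² + (#Q − k)·(stuff)`; for `#Q = k` it equals `(4(k−1)/k)(a − k/2)² ≥ 0`. [new] -/
theorem cut_sum_sum_nonneg {k : ℕ} (hk : 0 < k) {S : Finset (Fin m)} {V : Fin m → Fin m → ℝ}
    (hVdef : ∀ x y, V x y = if x = y then 0 else
      if x ∈ S then (if y ∈ S then (1 : ℝ) else -(1 - 2 / (k : ℝ))) else (if y ∈ S then -(1 - 2 / (k : ℝ)) else 1))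
    (Q : Finset (Fin m)) (hQ : Q.card = k) :
    0 ≤ ∑ x ∈ Q, ∑ y ∈ Q, V x y := by
  classical
  rw [block_sum_sum hVdef Q]
  set a : ℝ := ((Q.filter (· ∈ S)).card : ℝ) with ha
  set b : ℝ := ((Q.filter (· ∉ S)).card : ℝ) with hb
  have hkR : (0 : ℝ) < k := by exact_mod_cast hk
  have hab : a + b = k := by
    rw [ha, hb, ← Nat.cast_add, Finset.card_filter_add_card_filter_not (s := Q) (fun x => x ∈ S), hQ]
  -- the expression equals `(4(k-1)/k)·(a - k/2)²`
  have hb' : b = k - a := by linarith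
  rw [hb']
  have key : a * ((a - 1) * 1) + ((k : ℝ) - a) * (((k : ℝ) - a - 1) * 1) +
      2 * a * ((k : ℝ) - a) * -(1 - 2 / (k : ℝ)) = (4 * ((k : ℝ) - 1) / k) * (a - k / 2) ^ 2 := by
    field_simp
    ring
  rw [key]
  have hk1 : (0 : ℝ) ≤ 4 * ((k : ℝ) - 1) / k := by
    have : (1 : ℝ) ≤ k := by exact_mod_cast hk
    exact div_nonneg (by linarith) hkR.le
  exact mul_nonneg hk1 (sq_nonneg _)

/-- **The ℓ₁-constant exceeds `k − 1`.** For `4 ≤ k`, `k + 2 ≤ m` there is a `k`-clique-non-negative edge weighting `w` of `K_m`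
with `0 < ∑ w` and `(k − 1)·∑_e w(e) < ∑_e |w(e)|` (the cut weighting of a balanced bipartition). [new] -/
theorem exists_cliqueNonneg_l1_gt {k : ℕ} (hk : 4 ≤ k) (hm : k + 2 ≤ m) :
    ∃ w : Edge m → ℝ, (∀ Q ∈ (Finset.univ : Finset (Fin m)).powersetCard k, 0 ≤ softWindow w Q) ∧
      0 < ∑ e, w e ∧ ((k : ℝ) - 1) * ∑ e, w e < ∑ e, |w e| := by
  classical
  have hk0 : 0 < k := by omega
  have hkR : (4 : ℝ) ≤ k := by exact_mod_cast hk
  have hkR0 : (0 : ℝ) < k := by linarith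
  have hmR : (k : ℝ) + 2 ≤ m := by exact_mod_cast hm
  -- the balanced bipartition
  set S : Finset (Fin m) := (Finset.univ : Finset (Fin m)).filter (fun x => (x : ℕ) < m / 2) with hS
  set θ : ℝ := 1 - 2 / (k : ℝ) with hθ
  have hθ0' : (0 : ℝ) ≤ 1 - 2 / (k : ℝ) := by
    rw [sub_nonneg, div_le_one hkR0]; linarith
  have hθ0 : 0 ≤ θ := hθ0'
  have hθ1 : θ ≤ 1 := by
    have : 0 ≤ 2 / (k : ℝ) := by positivity
    linarith [hθ]
  obtain ⟨V, hVdef⟩ : ∃ V : Fin m → Fin m → ℝ, ∀ x y, V x y = if x = y then 0 else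
      if x ∈ S then (if y ∈ S then (1 : ℝ) else -(1 - 2 / (k : ℝ))) else (if y ∈ S then -(1 - 2 / (k : ℝ)) else 1) :=
    ⟨fun x y => if x = y then 0 else
      if x ∈ S then (if y ∈ S then (1 : ℝ) else -(1 - 2 / (k : ℝ))) else (if y ∈ S then -(1 - 2 / (k : ℝ)) else 1),
      fun x y => rfl⟩
  have hVsym : ∀ x y, V x y = V y x := by
    intro x y
    rw [hVdef x y, hVdef y x]
    by_cases hxy : x = y
    · subst hxy; rfl
    · rw [if_neg hxy, if_neg (Ne.symm hxy)]
      by_cases hx : x ∈ S <;> by_cases hy : y ∈ S <;> simp [hx, hy]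
  have hV0 : ∀ x, V x x = 0 := fun x => by rw [hVdef, if_pos rfl]
  -- the absolute values form the block weighting with `γ = +θ`
  have hAdef : ∀ x y, |V x y| = if x = y then 0 else
      if x ∈ S then (if y ∈ S then (1 : ℝ) else θ) else (if y ∈ S then θ else 1) := by
    intro x y
    rw [hVdef]
    by_cases hxy : x = y
    · rw [if_pos hxy, if_pos hxy, abs_zero]
    · rw [if_neg hxy, if_neg hxy]
      by_cases hx : x ∈ S
      · by_cases hy : y ∈ S
        · rw [if_pos hx, if_pos hy, if_pos hx, if_pos hy, abs_one]
        · rw [if_pos hx, if_neg hy, if_pos hx, if_neg hy, abs_neg, hθ, abs_of_nonneg hθ0']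
      · by_cases hy : y ∈ S
        · rw [if_neg hx, if_pos hy, if_neg hx, if_pos hy, abs_neg, hθ, abs_of_nonneg hθ0']
        · rw [if_neg hx, if_neg hy, if_neg hx, if_neg hy, abs_one]
  -- the edge weighting
  set w : Edge m → ℝ := fun e => Sym2.lift ⟨V, hVsym⟩ e.1 with hw
  have hVoff : ∀ (x y : Fin m) (h : x ≠ y), V x y = w ⟨s(x, y), CliqueExtLowerBound.Negative.mk_mem_edgeSet_top h⟩ := by
    intro x y _; simp only [hw, Sym2.lift_mk]
  refine ⟨w, fun Q hQ => ?_, ?_⟩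
  · rw [softWindow_eq_half_sum_sum w V hV0 hVoff Q]
    exact div_nonneg (cut_sum_sum_nonneg hk0 hVdef Q (Finset.mem_powersetCard.1 hQ).2) (by norm_num)
  · have hmass : ∑ e, w e = (∑ x, ∑ y, V x y) / 2 := sum_edge_eq_half_sum_sum w V hV0 hVoff
    have habsmass : ∑ e, |w e| = (∑ x, ∑ y, |V x y|) / 2 :=
      sum_edge_eq_half_sum_sum (fun e => |w e|) (fun x y => |V x y|) (fun x => by rw [hV0, abs_zero])
        (fun x y h => by rw [hVoff x y h])
    rw [hmass, habsmass, block_sum_sum hVdef (Finset.univ : Finset (Fin m)),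
      block_sum_sum hAdef (Finset.univ : Finset (Fin m))]
    set a : ℝ := (((Finset.univ : Finset (Fin m)).filter (· ∈ S)).card : ℝ) with ha
    set b : ℝ := (((Finset.univ : Finset (Fin m)).filter (· ∉ S)).card : ℝ) with hb
    have hab : a + b = m := by
      rw [ha, hb, ← Nat.cast_add, Finset.card_filter_add_card_filter_not (s := Finset.univ) (fun x => x ∈ S),
        Finset.card_univ, Fintype.card_fin]
    -- `a = ⌊m/2⌋`, hence `(a - b)² ≤ 1`
    have hScard : S.card = m / 2 := by
      have h := Finset.card_bij (s := S) (t := Finset.range (m / 2)) (fun x _ => (x : ℕ))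
        (fun x hx => by
          rw [hS, Finset.mem_filter] at hx
          exact Finset.mem_range.2 hx.2)
        (fun x _ y _ hxy => Fin.ext hxy)
        (fun j hj => by
          rw [Finset.mem_range] at hj
          have hjm : j < m := lt_of_lt_of_le hj (Nat.div_le_self m 2)
          exact ⟨⟨j, hjm⟩, by rw [hS, Finset.mem_filter]; exact ⟨Finset.mem_univ _, hj⟩, rfl⟩)
      rw [h, Finset.card_range]
    have haS : ((Finset.univ : Finset (Fin m)).filter (· ∈ S)).card = m / 2 := by
      have hfilt : (Finset.univ : Finset (Fin m)).filter (· ∈ S) = S := by ext x; simp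
      rw [hfilt, hScard]
    have hb' : b = m - a := by linarith
    have hdiff : (a - b) ^ 2 ≤ 1 := by
      have hlo : 2 * a ≤ m := by
        rw [ha, haS]; exact_mod_cast Nat.mul_div_le m 2
      have hhi : (m : ℝ) ≤ 2 * a + 1 := by
        rw [ha, haS]
        have : m ≤ 2 * (m / 2) + 1 := by omega
        exact_mod_cast this
      rw [hb']
      have h1 : -1 ≤ a - ((m : ℝ) - a) := by linarith
      have h2 : a - ((m : ℝ) - a) ≤ 0 := by linarith
      nlinarith
    -- notation `I = a(a-1)+b(b-1)`, `X = 2ab`; `X - I = m - (a-b)²`, `2X = m² - (a-b)²`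
    have hX : 2 * a * b - (a * (a - 1) + b * (b - 1)) = m - (a - b) ^ 2 := by rw [hb']; ring
    have h4ab : 4 * a * b = (m : ℝ) ^ 2 - (a - b) ^ 2 := by rw [hb']; ring
    have hm2 : (2 : ℝ) ≤ m := by linarith
    have hXpos : 0 < 2 * a * b - (a * (a - 1) + b * (b - 1)) := by rw [hX]; linarith
    have hXle : 2 * a * b - (a * (a - 1) + b * (b - 1)) ≤ m := by rw [hX]; linarith [sq_nonneg (a - b)]
    have h2ab : (m : ℝ) * (m - 1) / 2 ≤ 2 * a * b := by nlinarith [h4ab, hdiff]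
    constructor
    · -- `∑ w > 0`: the double sum is `I - X + (2/k)·X ≥ -m + m(m-1)/k > 0`
      have hval : a * ((a - 1) * 1) + b * ((b - 1) * 1) + 2 * a * b * -(1 - 2 / (k : ℝ)) =
          (a * (a - 1) + b * (b - 1)) - 2 * a * b + (2 / (k : ℝ)) * (2 * a * b) := by ring
      rw [hval]
      have h4 : (2 / (k : ℝ)) * ((m : ℝ) * (m - 1) / 2) ≤ (2 / (k : ℝ)) * (2 * a * b) :=
        mul_le_mul_of_nonneg_left h2ab (by positivity)
      have h5 : (2 / (k : ℝ)) * ((m : ℝ) * (m - 1) / 2) = (m : ℝ) * (m - 1) / k := by field_simp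
      have h6 : (m : ℝ) < (m : ℝ) * (m - 1) / k := by
        rw [lt_div_iff₀ hkR0]
        have hkm : (k : ℝ) < (m : ℝ) - 1 := by linarith
        have := mul_lt_mul_of_pos_left hkm (by linarith : (0 : ℝ) < m)
        linarith
      apply div_pos _ (by norm_num : (0 : ℝ) < 2)
      linarith
    · -- `(k-1)·∑∑V < ∑∑|V|` iff `(k-2)·I < k·θ·X = (k-2)·X` iff `I < X`
      rw [mul_div_assoc', div_lt_div_iff_of_pos_right (by norm_num : (0 : ℝ) < 2)]
      have hval : a * ((a - 1) * 1) + b * ((b - 1) * 1) + 2 * a * b * -(1 - 2 / (k : ℝ)) =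
          (a * (a - 1) + b * (b - 1)) - θ * (2 * a * b) := by rw [hθ]; ring
      have hvalA : a * ((a - 1) * 1) + b * ((b - 1) * 1) + 2 * a * b * θ =
          (a * (a - 1) + b * (b - 1)) + θ * (2 * a * b) := by ring
      rw [hval, hvalA]
      have hkθ : (k : ℝ) * θ = k - 2 := by rw [hθ]; field_simp
      have hk2pos : (0 : ℝ) < (k : ℝ) - 2 := by linarith
      have e : (a * (a - 1) + b * (b - 1)) + θ * (2 * a * b) -
          ((k : ℝ) - 1) * ((a * (a - 1) + b * (b - 1)) - θ * (2 * a * b)) =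
          ((k : ℝ) - 2) * (2 * a * b - (a * (a - 1) + b * (b - 1))) +
            ((k : ℝ) * θ - ((k : ℝ) - 2)) * (2 * a * b) := by ring
      rw [hkθ, sub_self, zero_mul, add_zero] at e
      have hpos : 0 < ((k : ℝ) - 2) * (2 * a * b - (a * (a - 1) + b * (b - 1))) := mul_pos hk2pos hXpos
      linarith

/-- **The ℓ₁-constant exceeds `k − 1`** (registered form of `exists_cliqueNonneg_l1_gt`). [new] -/
theorem l1_constant_ge : ∀ {m k : ℕ}, 4 ≤ k → k + 2 ≤ m → ∃ w : Edge m → ℝ, (∀ Q ∈ (Finset.univ : Finset (Fin m)).powersetCard k, 0 ≤ softWindow w Q) ∧ 0 < ∑ e, w e ∧ ((k : ℝ) - 1) * ∑ e, w e < ∑ e, |w e| :=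
  fun hk hm => exists_cliqueNonneg_l1_gt hk hm

end

end Summit.PneNP.PneNP.Theorems
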